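import Summits.HubbardSuperconductivity.HubbardSuperconductivity.Theorems.AnisotropyChordTransferFibre3GreenZeroBose
import Summits.HubbardSuperconductivity.HubbardSuperconductivity.Theorems.AnisotropyChordTransferFibre3GreenZeroBrackets

/-!
# Route `AnisotropyChord` / H0 rotor rung: ★ THE TORUS CAPACITY CONSTANT — `|G̃₀(0) − ln L/(2π) − 0.0483| ≤ 0.0027` for every `L ≥ 64` (family A, LEMMA A0 at `λ = 0`)

Assembly of LEMMA A0 (LEVEL2-SPEC §3 family A, the one-propagator capacity that enters `Δ(λ)`, `c_s`, `f_nn` and every row of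
the GM₃ certificate; precision needed downstream ±.01 — the tree had the `±.1`-class `…CapacityUpper`/`…GresZeroSharp`):
* `…GreenZeroRowForm.Gres_zero_eq`: `G̃₀(0) = (1 − 1/L²)/12 + (1/L)Σ_{p=1}^{L−1}(1 + b_p)ψ₀(2πp/L)`;
* `…GreenZeroTrapezoid.farRows_trapezoid` (rows `4 … L−4`, one-sided trapezoidal rule for the convex `ψ₀`, closed-form primitive);
* `…GreenZeroBose.bose_sum_bounds` (`0 ≤ Bose part ≤ 7·10⁻⁴`);
* `…GreenZeroBrackets` (decimal brackets of the near rows, the far-row logarithm and the trapezoid remainder, from π / log 2 / log π bounds).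
Results: `Gres_zero_split` (the exact decomposition), ★ `capacity_const_bounds`:
**`0.0456 ≤ G̃₀(0) − ln L/(2π) ≤ 0.0510`** and ★ `abs_capacity_const_le`: **`|G̃₀(0) − ln L/(2π) − 0.0483| ≤ 0.0027`** for all `L ≥ 64`
(exact constant `c₀ = γ/2π + 1/12 + (½ln 2 − ln π)/2π + Σ_{m≥1} 1/(πm(e^{2πm} − 1)) = 0.0487656…`; the slack is the `O((π p/L)²)`
near-row brackets at `L = 64` and the one-sided trapezoid remainder `≤ 1/(256π)`).
Prover seat `hubbard-h0-rotor-p1` g26; helper for stmt-HubbardSuperconductivity-19089 (`--supports`, helper class).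
WHAT THIS IS NOT: nothing here proves superconductivity in the Hubbard model; it is ONE analytic input (family A) of the Level-2
programme for ONE conditional reduction (rung 19089).  Tree + Literature imports; no new definitions; no sorry, no axioms.
-/

set_option linter.dupNamespace false
set_option autoImplicit false

noncomputable section

open scoped BigOperators
open Real Finset

namespace Summit.HubbardSuperconductivity.HubbardSuperconductivity.Theorems.AnisotropyChord.Transfer.Fibre3

namespace CapacityConst

variable (L : ℕ) [NeZero L]

/-! ## The `ℤ`/`ℕ` index change -/

/-- an `ℤ`-indexed `Icc` sum with natural endpoints is the `ℕ`-indexed one. [folklore] -/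
theorem sum_Icc_int_eq (f : ℝ → ℝ) (a b : ℕ) :
    ∑ m ∈ Finset.Icc (a : ℤ) (b : ℤ), f (m : ℝ) = ∑ p ∈ Finset.Icc a b, f (p : ℝ) := by
  refine Finset.sum_nbij' (fun m : ℤ => m.toNat) (fun p : ℕ => (p : ℤ)) ?_ ?_ ?_ ?_ ?_
  · intro m hm; simp only [Finset.mem_Icc] at hm ⊢; omega
  · intro p hp; simp only [Finset.mem_Icc] at hp ⊢; omega
  · intro m hm; simp only [Finset.mem_Icc] at hm; omega
  · intro p _; simp
  · intro m hm
    simp only [Finset.mem_Icc] at hm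
    have e : ((m.toNat : ℕ) : ℝ) = (m : ℝ) := by
      rw [← Int.cast_natCast, Int.toNat_of_nonneg (by omega)]
    rw [e]

/-! ## The exact split of the capacity -/

/-- the plain row sum split into near rows (twice, by reflection) and far rows `4 … L−4` as a `ℤ`-indexed sum. [folklore] -/
theorem rowSum_split (hL : 8 ≤ L) :
    ∑ p ∈ (Finset.range L).erase 0, psiRow 0 (2 * Real.pi * p / L)
      = 2 * (psiRow 0 (2 * Real.pi * (1 : ℕ) / L) + psiRow 0 (2 * Real.pi * (2 : ℕ) / L)
            + psiRow 0 (2 * Real.pi * (3 : ℕ) / L))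
          + ∑ m ∈ Finset.Icc (4 : ℤ) ((L : ℤ) - 4), psiRow 0 (2 * Real.pi * (m : ℝ) / L) := by
  set f : ℕ → ℝ := fun p => psiRow 0 (2 * Real.pi * p / L) with hf
  rw [Finset.range_eq_Ico, ← Nat.Ico_succ_left_eq_erase_Ico]
  show ∑ p ∈ Finset.Ico 1 L, f p = _
  rw [← Finset.sum_Ico_consecutive f (show 1 ≤ 4 by norm_num) (show 4 ≤ L by omega),
    ← Finset.sum_Ico_consecutive f (show 4 ≤ L - 3 by omega) (show L - 3 ≤ L by omega)]
  -- near rows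
  have hnear : ∑ p ∈ Finset.Ico 1 4, f p = f 1 + f 2 + f 3 := by
    rw [Finset.sum_Ico_eq_sum_range, show 4 - 1 = 3 from rfl, Finset.sum_range_succ, Finset.sum_range_succ,
      Finset.sum_range_succ, Finset.sum_range_zero]
    ring_nf
  -- reflected near rows
  have hnear' : ∑ p ∈ Finset.Ico (L - 3) L, f p = f 1 + f 2 + f 3 := by
    rw [Finset.sum_Ico_eq_sum_range, show L - (L - 3) = 3 by omega, Finset.sum_range_succ,
      Finset.sum_range_succ, Finset.sum_range_succ, Finset.sum_range_zero, zero_add, add_zero,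
      show L - 3 + 1 = L - 2 by omega, show L - 3 + 2 = L - 1 by omega]
    simp only [hf]
    rw [psiRow_row_reflect L 3 (by omega), psiRow_row_reflect L 2 (by omega), psiRow_row_reflect L 1 (by omega)]
    ring
  -- far rows as the `ℤ`-indexed sum
  have hfar : ∑ p ∈ Finset.Ico 4 (L - 3), f p
      = ∑ m ∈ Finset.Icc (4 : ℤ) ((L : ℤ) - 4), psiRow 0 (2 * Real.pi * (m : ℝ) / L) := by
    have e1 : Finset.Ico 4 (L - 3) = Finset.Icc 4 (L - 4) := by
      rw [show L - 3 = (L - 4) + 1 by omega]; exact Finset.Ico_add_one_right_eq_Icc 4 (L - 4)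
    have e2 : ((L : ℤ) - 4) = ((L - 4 : ℕ) : ℤ) := by push_cast [show 4 ≤ L by omega]; ring
    rw [e1, e2, show ((4 : ℤ)) = ((4 : ℕ) : ℤ) by norm_num,
      sum_Icc_int_eq (fun y => psiRow 0 (2 * Real.pi * y / L)) 4 (L - 4)]
  rw [hnear, hnear', hfar]
  simp only [hf]
  push_cast
  ring

/-- ★ the capacity split into the zero row, three near rows (twice), the far rows `4 … L−4`, and the Bose part. [folklore] -/
theorem Gres_zero_split (hL : 8 ≤ L) :
    Gres L 0 0 = (1 - 1 / (L : ℝ) ^ 2) / 12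
      + (2 * (psiRow 0 (2 * Real.pi * (1 : ℕ) / L) + psiRow 0 (2 * Real.pi * (2 : ℕ) / L)
            + psiRow 0 (2 * Real.pi * (3 : ℕ) / L))
          + ∑ m ∈ Finset.Icc (4 : ℤ) ((L : ℤ) - 4), psiRow 0 (2 * Real.pi * (m : ℝ) / L)) / L
      + (∑ p ∈ (Finset.range L).erase 0,
          2 / (Real.exp (L * RateLemma.rowMu L p) - 1) * psiRow 0 (2 * Real.pi * p / L)) / L := by
  rw [Gres_zero_eq L (by omega)]
  have hsplit : (∑ p ∈ (Finset.range L).erase 0,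
        (1 + 2 / (Real.exp (L * RateLemma.rowMu L p) - 1)) * psiRow 0 (2 * Real.pi * p / L))
      = (∑ p ∈ (Finset.range L).erase 0, psiRow 0 (2 * Real.pi * p / L))
        + ∑ p ∈ (Finset.range L).erase 0,
            2 / (Real.exp (L * RateLemma.rowMu L p) - 1) * psiRow 0 (2 * Real.pi * p / L) := by
    rw [← Finset.sum_add_distrib]
    refine Finset.sum_congr rfl (fun p _ => by ring)
  rw [hsplit, rowSum_split L hL, add_div]
  ring

/-! ## ★ The capacity constant -/

/-- ★★★ **THE TORUS CAPACITY CONSTANT** (LEMMA A0 at `λ = 0`): for every `L ≥ 64`,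
`0.0456 ≤ G̃₀(0) − ln L/(2π) ≤ 0.0510`. [folklore] -/
theorem capacity_const_bounds (hL : 64 ≤ L) :
    0.0456 ≤ Gres L 0 0 - Real.log L / (2 * Real.pi) ∧
      Gres L 0 0 - Real.log L / (2 * Real.pi) ≤ 0.0510 := by
  have hL0 : (0 : ℝ) < L := by exact_mod_cast (show 0 < L by omega)
  have hL64 : (64 : ℝ) ≤ L := by exact_mod_cast hL
  have hsplit := Gres_zero_split L (by omega)
  -- (0) the zero row
  have h0lo : (1 : ℝ) / 12 - 0.0000204 ≤ (1 - 1 / (L : ℝ) ^ 2) / 12 := by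
    have : 1 / (L : ℝ) ^ 2 ≤ 1 / 64 ^ 2 := one_div_le_one_div_of_le (by norm_num) (by nlinarith)
    linarith
  have h0hi : (1 - 1 / (L : ℝ) ^ 2) / 12 ≤ 1 / 12 := by
    have : 0 ≤ 1 / (L : ℝ) ^ 2 := by positivity
    linarith
  -- (1) near rows and the endpoint row
  obtain ⟨hN1lo, hN1hi⟩ := nearRow_bracket L hL 1 one_pos (by norm_num) 0.00241 0.0796096 0.0794816
    (by norm_num) (by norm_num) (by norm_num) (by norm_num)
  obtain ⟨hN2lo, hN2hi⟩ := nearRow_bracket L hL 2 (by norm_num) (by norm_num) 0.00964 0.0398528 0.0395978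
    (by norm_num) (by norm_num) (by norm_num) (by norm_num)
  obtain ⟨hN3lo, hN3hi⟩ := nearRow_bracket L hL 3 (by norm_num) (by norm_num) 0.021687 0.0266221 0.0262412
    (by norm_num) (by norm_num) (by norm_num) (by norm_num)
  obtain ⟨hN4lo, hN4hi⟩ := nearRow_bracket L hL 4 (by norm_num) (by norm_num) 0.038554 0.0200231 0.0195181
    (by norm_num) (by norm_num) (by norm_num) (by norm_num)
  -- (2) the far rows
  obtain ⟨hF1, hF2⟩ := farRows_trapezoid L 4 (by norm_num) (by omega)
  obtain ⟨hLOGlo, hLOGhi⟩ := farLog_bracket L hL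
  obtain ⟨hE0, hE⟩ := farRemainder_bound L hL
  -- (3) the Bose part
  obtain ⟨hBlo, hBhi⟩ := bose_sum_bounds L hL
  -- the far sum divided by `L`
  set FS := ∑ m ∈ Finset.Icc (4 : ℤ) ((L : ℤ) - 4), psiRow 0 (2 * Real.pi * (m : ℝ) / L) with hFS
  set LG := (L : ℝ) / (4 * Real.pi) * Real.log ((1 + Real.sqrt (1 - Real.sin (Real.pi * (4 : ℕ) / L) ^ 4))
            / Real.sin (Real.pi * (4 : ℕ) / L) ^ 2) with hLG
  set DD := Real.pi / (2 * L) * ((Real.sin (Real.pi * (4 : ℕ) / L) * Real.cos (Real.pi * (4 : ℕ) / L)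
          * (1 + 2 * Real.sin (Real.pi * (4 : ℕ) / L) ^ 2))
        / (8 * (Real.sin (Real.pi * (4 : ℕ) / L) ^ 2 * (1 + Real.sin (Real.pi * (4 : ℕ) / L) ^ 2))
          * Real.sqrt (Real.sin (Real.pi * (4 : ℕ) / L) ^ 2 * (1 + Real.sin (Real.pi * (4 : ℕ) / L) ^ 2))))
    with hDD
  have hLG' : LG / L = 1 / (4 * Real.pi) * Real.log ((1 + Real.sqrt (1 - Real.sin (Real.pi * (4 : ℕ) / L) ^ 4))
            / Real.sin (Real.pi * (4 : ℕ) / L) ^ 2) := by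
    rw [hLG]; field_simp
  have hFlo : LG / L + psiRow 0 (2 * Real.pi * (4 : ℕ) / L) / L ≤ FS / L := by
    rw [← add_div]; exact div_le_div_of_nonneg_right (by linarith) hL0.le
  have hFhi : FS / L ≤ LG / L + psiRow 0 (2 * Real.pi * (4 : ℕ) / L) / L + DD / L := by
    rw [← add_div, ← add_div]; exact div_le_div_of_nonneg_right (by linarith) hL0.le
  rw [hLG'] at hFlo hFhi
  have e : (2 * (psiRow 0 (2 * Real.pi * (1 : ℕ) / L) + psiRow 0 (2 * Real.pi * (2 : ℕ) / L)
        + psiRow 0 (2 * Real.pi * (3 : ℕ) / L)) + FS) / L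
      = 2 * (psiRow 0 (2 * Real.pi * (1 : ℕ) / L) / L + psiRow 0 (2 * Real.pi * (2 : ℕ) / L) / L
        + psiRow 0 (2 * Real.pi * (3 : ℕ) / L) / L) + FS / L := by
    field_simp
  rw [hsplit, e]
  constructor <;> linarith

/-- ★★★ `|G̃₀(0) − ln L/(2π) − 0.0483| ≤ 0.0027` for every `L ≥ 64` (exact constant `0.0487656…`). [folklore] -/
theorem abs_capacity_const_le (hL : 64 ≤ L) :
    |Gres L 0 0 - Real.log L / (2 * Real.pi) - 0.0483| ≤ 0.0027 := by
  obtain ⟨h1, h2⟩ := capacity_const_bounds L hL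
  rw [abs_le]; constructor <;> linarith

end CapacityConst

end Summit.HubbardSuperconductivity.HubbardSuperconductivity.Theorems.AnisotropyChord.Transfer.Fibre3

end
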